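import Summits.QuantumFields.YangMills.Theorems.BalabanUVNodesK0Stub2DatumForm
import Literature.MathematicalPhysics.QuantumFieldTheory.Balaban1983to89.Node00.CarriersB8CubePrint

/-!
# K0⁷ STUB 2′ (plan V19 `stub_prop6MemberB8AtP13`) — ITS INDEX-FREE NORMAL FORM: «[6] Prop. 6 at EVERY bare PRINT-FAITHFUL cube datum
# (corner on the `ρ₀`-grid, `ρ₀ ∣ ρ`, `ρ₀ ∣ M`) under the MINIMAL smallness» — the `zdCubP` twin of `BalabanUVNodesK0Stub2DatumForm` (g0, p584299)

Cell `pub-ymgap`, seat `pub-ymgap-k0-s2-w2` g2 (K0⁷ stub-2 width seat 2∕2, director-ym №197 ∕ HUMAN RULING D-0149).  Key K0⁷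
**stmt-QuantumFields-20541** (`Record13SepCoPHInhabited`), `--kind proof --supports stmt-QuantumFields-20541 --as helper`.
[6] = [Balaban1985RegularSpaces] (Prop. 6 p. 99, p. 98); [15] = [Balaban1985Variational] ((144)–(152) pp. 300–301).

THE STUB (plan g80 V19 draft kit `D80-K0V19-draft/`, text of record = plan g79 l.24860 ∕ dag-n21-c PART 2 `h2P`):
`Prop6MemberB8AtP F := ∃ ρ₀ B₁ c₁, 1 ≤ ρ₀ ∧ 0 ≤ B₁ ∧ 0 < c₁ ∧ B8.Prop6Printed 4 (F.L:ℝ) B₁ c₁ (fun i : ZdIdx 4 F.L => zdCubP (MatA 2) F.L ρ₀ i)` —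
[6] Proposition 6 at node00-def-cube's member CUT TO PRINT'S p. 98 CUBE CLASS at big-block size `ρ₀ = R₁M₁` (`Node00.CarriersB8CubePrint`, (b1) of plan
g79's repair (R-b), p587541): every ambient member `i : ZdIdx 4 F.L`, every cube `c : Node00.CubeB8 4 L i.k i.Ω` WITH `c.IsPrint ρ₀` (`ρ₀ ∣ ρ`, `ρ₀ ∣ M`,
`ρ₀ ∣ a_l`).

WHAT THIS FILE PROVES (kernel; theorems only, 0 `def`).
§1 ★ `prop6Printed_zdCubP_of_minimal` (SUPPLIER NORMAL FORM at `ρ₀`): if for every spacing `η > 0`, every PRINT cube datum `c` at `ρ₀` (over any ambient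
   family), every unitary `U₀` with the MINIMAL smallness (level-`j` conditions (1.7)∕(1.9) on `□̃` for `j < k`, level-`k` on `□` — g0's
   `condAt_tcube_of_inAk` ∕ `condAt_box_of_inAk`) and «`7dL²·M·α₀ ≤ c₁`» one has `GaugedBoundB8 L η U₀ c (7dL²B₁·M·α₀)`, then
   `B8.Prop6Printed d L B₁ c₁ (zdCubP 𝔸 L ρ₀ ∘ f)` for EVERY index map `f`.
   ★ `gaugedBoundB8_of_prop6Printed_zdCubP_minimal` (THE CONVERSE): the cut member sentence over the whole index FORCES Prop. 6 at EVERY print cube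
   datum at `ρ₀` under the minimal smallness (g0's minimal member `(□̃, …, □̃, □)` carries the datum; `IsPrint` reads only `(a, M, ρ)`, so the transported
   cube is print at `ρ₀` too).
   ★★ `prop6Printed_zdCubP_iff_minimal` — hence stub 2′'s `B8.Prop6Printed`-conjunct at `ρ₀` is EQUIVALENT to the bare-datum sentence: «for every
   `η > 0`, `k ≥ 1`, corner `a ∈ ρ₀ℤᵈ`, side `M ∈ ρ₀ℕ`, collar `ρ ∈ ρ₀ℕ` with `L ≤ ρ ≤ M`, `11d < M`, `L ≤ dM`, every unitary `U₀` with
   `|U₀(∂p) − 1| < α₀L^{−2j}`, `|D*∂U₀| < α₀L^{−2j}(Lʲη)⁻¹` on `□̃` (`j < k`) and on `□` (`j = k`), and `7dL²Mα₀ ≤ c₁`: (1.135)–(1.138) with `7dL²B₁Mα₀`».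
§2 `prop6MemberB8AtP_iff_minimal` — the same at the K0 letters (`d = 4`, `𝔸 = MatA N`, `L = F.L`); ★ `prop6MemberB8AtPBody_iff_minimal` — V19's stub-2′
   BODY `∃ ρ₀ B₁ c₁, 1 ≤ ρ₀ ∧ 0 ≤ B₁ ∧ 0 < c₁ ∧ …` (at `N = 2`, spelled verbatim) ⟺ `∃ ρ₀ B₁ c₁, 1 ≤ ρ₀ ∧ 0 ≤ B₁ ∧ 0 < c₁ ∧` «print's sentence over
   the `ρ₀`-class under the minimal smallness».
§3 `minimalP_one_iff_minimal` (sanity): at `ρ₀ = 1` the print-class sentence IS g0's bare sentence (`IsPrint.one`) — V18 stub 2 = the `ρ₀ = 1` instance;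
   `prop6MemberB8AtPBody_iff_dvd` — WLOG the big block is a multiple of any `t ≥ 1` (e.g. of `L`): `(∃ ρ₀ …) ↔ (∃ ρ₀, t ∣ ρ₀ ∧ …)` (`prop6Printed_zdCubP_anti`).

LOCATED (for V19's HONEST FRAMING; K0 side).  By §1–§2, stub 2′ = [6] Proposition 6 on print's p. 98 cube class «□ a union of cubes of the size
R₁M₁Lʲη … M a multiple of R₁M₁ … distance between boundaries … R₁M₁Lʲη … □_j a sum of the big blocks» FOR SOME big-block size `R₁M₁ = ρ₀`
(print: «R₁, M₁ are smallest integers for which all the theorems of the papers [2, 4] are valid» — an EXISTENTIAL over thresholds, exactly the stub's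
`∃ ρ₀`), with constants `(B₁, c₁)` depending on `d, L` only, the ambient admissible family being irrelevant — and NOTHING WIDER: the thin-collar ∕
ragged-side surplus of V18's stub 2 (g0 LOCATED-CARRIER, evidence #22 on 20541: stub 2 = Prop. 6 down to `ρ = L`) is GONE.  Collars `ρ ∈ ρ₀ℕ`
thicker than print's exact `ρ = R₁M₁` remain in the class (the consumer, dag-n07-e's `propCubeP`, reads `ρ = ρ₀·L` exactly; the supplier letters of
record are stated for all `ρ` above threshold divisible by the big block — `K0Stub2PrimeJunction.prop6MemberB8AtP_of_perCubeLetterPow`).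

HONEST FRAMING: bookkeeping about TREE-typed sentences; nothing of Bałaban is asserted, proved or refuted here; stub 2 ∕ 2′ NEITHER proved NOR
refuted; K0⁷ OPEN; N05 ∕ N07 NOT discharged; V18 3bcb71246bb7298d STANDS until the plan registers V19; counts unmoved (typed 28∕28 · discharged 5∕27);
one finite `𝕋⁴` programme at fixed `ε = L^{−K}`; the YM mass gap (Clay) is NOT proved by any of this — R4 closes the conditional finite-`𝕋⁴` rung
`BalabanLadder.UV` only; nothing continuum ∕ ℝ⁴ ∕ OS.  THEOREMS ONLY: no `def`, `instance`, `notation`, `sorry`; standard axioms; default heartbeats.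
-/

noncomputable section

open scoped Matrix.Norms.L2Operator

namespace Summit.QuantumFields.YangMills.Theorems.K0Stub2PrimeDatumForm

open Literature.MathematicalPhysics.QuantumFieldTheory.Balaban1983to89
open Literature.MathematicalPhysics.QuantumFieldTheory.Balaban1983to89.Node00
open Literature.MathematicalPhysics.QuantumFieldTheory.Balaban1983to89.T4Continuum
open B7Prop1Explicit (Site)
open B7Prop1Local (InBox)
open B7Prop2Explicit (unitaryUnits)
open B8LeafModelZd (ZdIdx)
open B8Ineq132 (InAk CondAt condAt_anti)
open B8Eq131Cubes (box tcube cube_subset_tcube)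
open Summit.QuantumFields.YangMills.Theorems.K0Stub2DatumForm (gaugedBoundB8_iff_of_data_eq condAt_tcube_of_inAk condAt_box_of_inAk
  prop6Printed_zdCub_iff_minimal)

/-! ## §1  The cut member sentence over the whole index ⟺ Proposition 6 at every bare PRINT datum under the minimal smallness -/

section NormalForm

variable {d : ℕ} {𝔸 : Type} [CStarAlgebra 𝔸]

/-- ★ **SUPPLIER NORMAL FORM AT BIG-BLOCK SIZE `ρ₀`**: Proposition 6's (1.135)–(1.138) at every PRINT cube datum at `ρ₀` (over any ambient family) for
every unitary `U₀` under the MINIMAL smallness — level-`j` conditions on `□̃` for `j < k`, level-`k` conditions on `□` — and «`7dL²Mα₀ ≤ c₁`» IMPLIES the cut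
member sentence `B8.Prop6Printed d L B₁ c₁ (zdCubP 𝔸 L ρ₀ ∘ f)` for every index map `f` (an ambient `U₀ ∈ 𝔄_K({Ω_j}, α₀)` hands the cube exactly the
minimal smallness). [cite: Balaban1985RegularSpaces, Prop. 6 (1.135)–(1.138) p.99, (1.7)–(1.9) p.77, p.98 («M is a multiple of R₁M₁»)] -/
theorem prop6Printed_zdCubP_of_minimal {L : ℕ} (ρ₀ : ℕ) {B₁ c₁ : ℝ}
    (H : ∀ (η : ℝ), 0 < η → ∀ {K : ℕ} {Ω : ℕ → Set (Site d)} (c : CubeB8 d L K Ω), c.IsPrint ρ₀ → ∀ (α₀ : ℝ), 0 < α₀ →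
      ∀ (U₀ : Site d → Fin d → 𝔸ˣ), (∀ x κ, U₀ x κ ∈ unitaryUnits 𝔸) →
      (∀ j, j < c.k → CondAt L η α₀ j (tcube L c.a c.M c.ρ c.k) U₀) → CondAt L η α₀ c.k (box L c.a c.M c.k) U₀ →
      7 * d * (L : ℝ) ^ 2 * c.M * α₀ ≤ c₁ → GaugedBoundB8 L η U₀ c (7 * d * (L : ℝ) ^ 2 * B₁ * c.M * α₀))
    {ι : Type} (f : ι → ZdIdx d L) :
    B8.Prop6Printed d (L : ℝ) B₁ c₁ (fun j => zdCubP 𝔸 L ρ₀ (f j)) := by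
  rw [prop6Printed_zdCubP_iff]
  intro j α₀ hα U₀ hInA c hc hs
  exact H (f j).η (f j).hη c hc α₀ hα U₀.1 U₀.2 (fun j' hj' => condAt_tcube_of_inAk (f j).hΩ c hInA hj') (condAt_box_of_inAk c hInA) hs

/-- ★ **THE CONVERSE**: the cut member sentence `B8.Prop6Printed d L B₁ c₁ (zdCubP 𝔸 L ρ₀ ·)` over n05-a's WHOLE index FORCES Proposition 6's
(1.135)–(1.138) at EVERY print cube datum `c` at `ρ₀` (over any ambient family: only `(k, a, M, ρ)` is read) for every unitary `U₀` under the MINIMAL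
smallness — the family `(□̃, …, □̃, □)` (levels `j < k` all `□̃`, top level `□`; the single sites of `□̃` as level-`0` towers, no constraint bonds — g0's
minimal member) IS a lawful member of `ZdIdx d L` carrying the datum, the transported cube has the same `(a, M, ρ)` hence is print at `ρ₀`, and there `𝔄_k`
asks exactly the minimal smallness. [cite: Balaban1985RegularSpaces, Prop. 6 (1.135)–(1.138) p.99, (1.3)–(1.9) p.77, p.98 («we can drop out the domains Ω_{j′}, j′ > j»)] -/
theorem gaugedBoundB8_of_prop6Printed_zdCubP_minimal {L ρ₀ : ℕ} {B₁ c₁ : ℝ}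
    (hP6 : B8.Prop6Printed d (L : ℝ) B₁ c₁ (fun i : ZdIdx d L => zdCubP 𝔸 L ρ₀ i))
    (η : ℝ) (hη : 0 < η) {K : ℕ} {Ω : ℕ → Set (Site d)} (c : CubeB8 d L K Ω) (hc : c.IsPrint ρ₀) (α₀ : ℝ) (hα : 0 < α₀)
    (U₀ : Site d → Fin d → 𝔸ˣ) (hU : ∀ x κ, U₀ x κ ∈ unitaryUnits 𝔸)
    (hlow : ∀ j, j < c.k → CondAt L η α₀ j (tcube L c.a c.M c.ρ c.k) U₀) (htop : CondAt L η α₀ c.k (box L c.a c.M c.k) U₀)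
    (hs : 7 * d * (L : ℝ) ^ 2 * c.M * α₀ ≤ c₁) :
    GaugedBoundB8 L η U₀ c (7 * d * (L : ℝ) ^ 2 * B₁ * c.M * α₀) := by
  -- the minimal ambient family `(□̃, …, □̃, □)` and its member of `ZdIdx d L` (g0's construction, `K0Stub2DatumForm`)
  have hbt : box L c.a c.M c.k ⊆ tcube L c.a c.M c.ρ c.k := box_subset_tcube_of_le L c.a le_rfl c.ρ c.k
  let Ωm : ℕ → Set (Site d) := fun j => if j < c.k then tcube L c.a c.M c.ρ c.k else box L c.a c.M c.k
  have hΩm_lt : ∀ j, j < c.k → Ωm j = tcube L c.a c.M c.ρ c.k := fun j hj => if_pos hj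
  have hΩm_top : Ωm c.k = box L c.a c.M c.k := if_neg (lt_irrefl _)
  have hΩm0 : Ωm 0 = tcube L c.a c.M c.ρ c.k := hΩm_lt 0 c.one_le_k
  have hΩm_anti : ∀ j, Ωm (j + 1) ⊆ Ωm j := by
    intro j
    by_cases h1 : j + 1 < c.k
    · rw [hΩm_lt _ h1, hΩm_lt _ (by omega)]
    · by_cases h0 : j < c.k
      · simp only [Ωm, if_neg h1, if_pos h0]; exact hbt
      · simp only [Ωm, if_neg h1, if_neg h0]; exact le_rfl
  let i : ZdIdx d L :=
    { η := η
      hη := hη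
      k := c.k
      hk := c.one_le_k
      Ω := Ωm
      hΩ := hΩm_anti
      Λs := fun _ j => if j = 0 then tcube L c.a c.M c.ρ c.k else ∅
      Λb := fun _ _ => ∅
      hbox := fun _ _ _ _ b hb => (Set.notMem_empty b hb).elim
      hclass := fun _ _ _ _ b hb => (Set.notMem_empty b hb).elim
      htower := by
        intro j _ y hy x hx
        by_cases hj : j = 0
        · subst hj
          rw [if_pos rfl] at hy
          have hxy : x = y := funext fun l => le_antisymm (hx l).2 (hx l).1
          rw [hxy]
          show y ∈ Ωm 0
          rw [hΩm0]; exact hy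
        · rw [if_neg hj] at hy
          exact (Set.notMem_empty y hy).elim
      hpart := fun x hx => ⟨0, Nat.zero_le _, x, by rw [if_pos rfl]; exact (show x ∈ Ωm 0 from hx) |> fun h => by rwa [hΩm0] at h,
        fun l => ⟨le_rfl, le_rfl⟩⟩ }
  -- the datum as a cube of that member; it is print at `ρ₀` because `IsPrint` reads only `(a, M, ρ)`
  let c₀ : CubeB8 d L i.k i.Ω :=
    ⟨c.k, c.a, c.M, c.ρ, c.one_le_k, le_rfl, c.L_le_ρ, c.ρ_le_M, c.big, c.L_le_dM,
      by show box L c.a c.M c.k ⊆ Ωm c.k; rw [hΩm_top],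
      by show tcube L c.a c.M c.ρ c.k ⊆ Ωm (c.k - 1); rw [hΩm_lt _ (by have := c.one_le_k; omega)]⟩
  have hc₀ : c₀.IsPrint ρ₀ := ⟨hc.rho_dvd, hc.side_dvd, hc.corner_dvd⟩
  -- the member's `𝔄_k` is the minimal smallness
  have hInAk : InAk L i.k i.η α₀ i.Ω U₀ := by
    intro j hj
    show CondAt L η α₀ j (Ωm j) U₀
    rcases Nat.lt_or_ge j c.k with hjk | hjk
    · rw [hΩm_lt j hjk]; exact hlow j hjk
    · have : j = c.k := le_antisymm hj hjk
      subst this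
      rw [hΩm_top]; exact htop
  have hG : GaugedBoundB8 L i.η U₀ c₀ (7 * d * (L : ℝ) ^ 2 * B₁ * c₀.M * α₀) :=
    (prop6Printed_zdCubP_iff (fun i : ZdIdx d L => i) ρ₀ B₁ c₁).1 hP6 i α₀ hα ⟨U₀, hU⟩ hInAk c₀ hc₀ hs
  exact (gaugedBoundB8_iff_of_data_eq L η U₀ c c₀ rfl rfl rfl rfl _).2 hG

/-- ★★ **STUB 2′'s `B8.Prop6Printed`-CONJUNCT IN NORMAL FORM**: the cut member sentence at big-block size `ρ₀` over n05-a's whole index `ZdIdx d L` is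
EQUIVALENT to «Proposition 6's (1.135)–(1.138) at every PRINT cube datum (`η > 0`; `1 ≤ k ≤ K`; `a ∈ ρ₀ℤᵈ`; `ρ, M ∈ ρ₀ℕ`, `L ≤ ρ ≤ M`, `11d < M`, `L ≤ dM`)
of any ambient family, for every unitary `U₀` with the level-`j` conditions (1.7)∕(1.9) on `□̃` (`j < k`) and the level-`k` conditions on `□`, whenever
`7dL²Mα₀ ≤ c₁`, with the bound `7dL²B₁Mα₀`» — print's p. 98 cube class at `R₁M₁ = ρ₀`; the ambient member is IRRELEVANT.
[cite: Balaban1985RegularSpaces, Prop. 6 (1.135)–(1.138) p.99, p.98, (1.3)–(1.9) p.77] -/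
theorem prop6Printed_zdCubP_iff_minimal {L : ℕ} (ρ₀ : ℕ) (B₁ c₁ : ℝ) :
    B8.Prop6Printed d (L : ℝ) B₁ c₁ (fun i : ZdIdx d L => zdCubP 𝔸 L ρ₀ i) ↔
      ∀ (η : ℝ), 0 < η → ∀ {K : ℕ} {Ω : ℕ → Set (Site d)} (c : CubeB8 d L K Ω), c.IsPrint ρ₀ → ∀ (α₀ : ℝ), 0 < α₀ →
        ∀ (U₀ : Site d → Fin d → 𝔸ˣ), (∀ x κ, U₀ x κ ∈ unitaryUnits 𝔸) →
        (∀ j, j < c.k → CondAt L η α₀ j (tcube L c.a c.M c.ρ c.k) U₀) → CondAt L η α₀ c.k (box L c.a c.M c.k) U₀ →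
        7 * d * (L : ℝ) ^ 2 * c.M * α₀ ≤ c₁ → GaugedBoundB8 L η U₀ c (7 * d * (L : ℝ) ^ 2 * B₁ * c.M * α₀) :=
  ⟨fun hP6 η hη _ _ c hc α₀ hα U₀ hU hlow htop hs => gaugedBoundB8_of_prop6Printed_zdCubP_minimal hP6 η hη c hc α₀ hα U₀ hU hlow htop hs,
    fun H => prop6Printed_zdCubP_of_minimal ρ₀ H fun i : ZdIdx d L => i⟩

/-- **SANITY (`ρ₀ = 1`)**: the print-class bare sentence at `ρ₀ = 1` IS g0's bare sentence of `K0Stub2DatumForm.prop6Printed_zdCub_iff_minimal` (every cube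
is print at `1`, `IsPrint.one`) — V18's stub 2 is the `ρ₀ = 1` instance of V19's stub 2′ conjunct. [cite: Balaban1985RegularSpaces, Prop. 6 p.99, p.98 (bookkeeping)] -/
theorem minimalP_one_iff_minimal {L : ℕ} (B₁ c₁ : ℝ) :
    (∀ (η : ℝ), 0 < η → ∀ {K : ℕ} {Ω : ℕ → Set (Site d)} (c : CubeB8 d L K Ω), c.IsPrint 1 → ∀ (α₀ : ℝ), 0 < α₀ →
        ∀ (U₀ : Site d → Fin d → 𝔸ˣ), (∀ x κ, U₀ x κ ∈ unitaryUnits 𝔸) →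
        (∀ j, j < c.k → CondAt L η α₀ j (tcube L c.a c.M c.ρ c.k) U₀) → CondAt L η α₀ c.k (box L c.a c.M c.k) U₀ →
        7 * d * (L : ℝ) ^ 2 * c.M * α₀ ≤ c₁ → GaugedBoundB8 L η U₀ c (7 * d * (L : ℝ) ^ 2 * B₁ * c.M * α₀)) ↔
    B8.Prop6Printed d (L : ℝ) B₁ c₁ (fun i : ZdIdx d L => zdCub 𝔸 L i) := by
  rw [prop6Printed_zdCub_iff_minimal]
  exact ⟨fun H η hη _ _ c α₀ hα U₀ hU hlow htop hs => H η hη c (CubeB8.IsPrint.one c) α₀ hα U₀ hU hlow htop hs,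
    fun H η hη _ _ c _ α₀ hα U₀ hU hlow htop hs => H η hη c α₀ hα U₀ hU hlow htop hs⟩

/-- **WLOG THE BIG BLOCK IS A MULTIPLE OF ANY `t ≥ 1`** (e.g. of `L`, or of a supplier's `M_hL`): in the stub-2′ shape `∃ ρ₀ B₁ c₁, 1 ≤ ρ₀ ∧ 0 ≤ B₁ ∧ 0 < c₁ ∧ …`
the `∃ ρ₀` may be restricted to multiples of `t` — a witness at `ρ₀` is a witness at `ρ₀·t`, coarser big blocks being weaker (`prop6Printed_zdCubP_anti`).
[cite: Balaban1985RegularSpaces, Prop. 6 p.99, p.98 (bookkeeping)] -/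
theorem exists_prop6Printed_zdCubP_iff_dvd {L : ℕ} {t : ℕ} (ht : 1 ≤ t) :
    (∃ ρ₀ : ℕ, ∃ B₁ c₁ : ℝ, 1 ≤ ρ₀ ∧ 0 ≤ B₁ ∧ 0 < c₁ ∧ B8.Prop6Printed d (L : ℝ) B₁ c₁ (fun i : ZdIdx d L => zdCubP 𝔸 L ρ₀ i)) ↔
      ∃ ρ₀ : ℕ, ∃ B₁ c₁ : ℝ, 1 ≤ ρ₀ ∧ t ∣ ρ₀ ∧ 0 ≤ B₁ ∧ 0 < c₁ ∧ B8.Prop6Printed d (L : ℝ) B₁ c₁ (fun i : ZdIdx d L => zdCubP 𝔸 L ρ₀ i) := by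
  constructor
  · rintro ⟨ρ₀, B₁, c₁, hρ₀, hB₁, hc₁, h6⟩
    exact ⟨ρ₀ * t, B₁, c₁, le_trans hρ₀ (Nat.le_mul_of_pos_right ρ₀ ht), Dvd.intro_left ρ₀ rfl, hB₁, hc₁,
      prop6Printed_zdCubP_anti (fun i : ZdIdx d L => i) (Dvd.intro t rfl) h6⟩
  · rintro ⟨ρ₀, B₁, c₁, hρ₀, -, hB₁, hc₁, h6⟩
    exact ⟨ρ₀, B₁, c₁, hρ₀, hB₁, hc₁, h6⟩

end NormalForm

/-! ## §2  The same at the K0 letters (`d = 4`, `𝔸 = M_N(ℂ)`, `L = F.L`); V19's stub-2′ body -/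

section K0Letters

variable (F : T4Family) (N : ℕ)

/-- **STUB 2′'s `B8.Prop6Printed`-CONJUNCT AT THE K0 LETTERS, NORMAL FORM** (`d = 4`, `𝔸 = MatA N` with NODE 00's C⋆-structure, `L = F.L`): at big-block size
`ρ₀` the cut member sentence holds with `(B₁, c₁)` iff Proposition 6's (1.135)–(1.138) hold at EVERY print cube datum of `ℤ⁴` at `ρ₀` under the minimal
smallness with `7·4·L²·B₁·M·α₀`. [cite: Balaban1985RegularSpaces, Prop. 6 (1.135)–(1.138) p.99, p.98] -/
theorem prop6MemberB8AtP_iff_minimal (ρ₀ : ℕ) (B₁ c₁ : ℝ) :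
    (letI : CStarAlgebra (MatA N) := {};
      B8.Prop6Printed 4 (F.L : ℝ) B₁ c₁ (fun i : ZdIdx 4 F.L => zdCubP (MatA N) F.L ρ₀ i)) ↔
    (letI : CStarAlgebra (MatA N) := {};
      ∀ (η : ℝ), 0 < η → ∀ {K : ℕ} {Ω : ℕ → Set (Site 4)} (c : CubeB8 4 F.L K Ω), c.IsPrint ρ₀ → ∀ (α₀ : ℝ), 0 < α₀ →
        ∀ (U₀ : Site 4 → Fin 4 → (MatA N)ˣ), (∀ x κ, U₀ x κ ∈ unitaryUnits (MatA N)) →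
        (∀ j, j < c.k → CondAt F.L η α₀ j (tcube F.L c.a c.M c.ρ c.k) U₀) → CondAt F.L η α₀ c.k (box F.L c.a c.M c.k) U₀ →
        7 * (4 : ℕ) * (F.L : ℝ) ^ 2 * c.M * α₀ ≤ c₁ → GaugedBoundB8 F.L η U₀ c (7 * (4 : ℕ) * (F.L : ℝ) ^ 2 * B₁ * c.M * α₀)) := by
  letI : CStarAlgebra (MatA N) := {}
  exact prop6Printed_zdCubP_iff_minimal (𝔸 := MatA N) ρ₀ B₁ c₁

/-- ★ **V19's STUB-2′ BODY `Prop6MemberB8AtP F` (spelled verbatim, `N = 2`) IN NORMAL FORM**: `∃ ρ₀ B₁ c₁, 1 ≤ ρ₀ ∧ 0 ≤ B₁ ∧ 0 < c₁ ∧` «[6] Prop. 6 with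
`7·4·L²·B₁·M·α₀` at every print cube datum of `ℤ⁴` at big-block size `ρ₀`, every unitary `U₀ : ℤ⁴-bonds → U(2)`-valued configuration under the minimal
smallness, whenever `7·4·L²·M·α₀ ≤ c₁`» — print's Proposition 6 on print's p. 98 class for SOME `R₁M₁ = ρ₀` and constants depending on `L` only.
[cite: Balaban1985RegularSpaces, Prop. 6 (1.135)–(1.138) p.99, p.98 («R₁, M₁ are smallest integers for which all the theorems of the papers [2, 4] are valid»)] -/
theorem prop6MemberB8AtPBody_iff_minimal :
    (∃ ρ₀ : ℕ, ∃ B₁ c₁ : ℝ, 1 ≤ ρ₀ ∧ 0 ≤ B₁ ∧ 0 < c₁ ∧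
      (letI : CStarAlgebra (MatA 2) := {};
        B8.Prop6Printed 4 (F.L : ℝ) B₁ c₁ (fun i : ZdIdx 4 F.L => zdCubP (MatA 2) F.L ρ₀ i))) ↔
    (∃ ρ₀ : ℕ, ∃ B₁ c₁ : ℝ, 1 ≤ ρ₀ ∧ 0 ≤ B₁ ∧ 0 < c₁ ∧
      (letI : CStarAlgebra (MatA 2) := {};
        ∀ (η : ℝ), 0 < η → ∀ {K : ℕ} {Ω : ℕ → Set (Site 4)} (c : CubeB8 4 F.L K Ω), c.IsPrint ρ₀ → ∀ (α₀ : ℝ), 0 < α₀ →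
          ∀ (U₀ : Site 4 → Fin 4 → (MatA 2)ˣ), (∀ x κ, U₀ x κ ∈ unitaryUnits (MatA 2)) →
          (∀ j, j < c.k → CondAt F.L η α₀ j (tcube F.L c.a c.M c.ρ c.k) U₀) → CondAt F.L η α₀ c.k (box F.L c.a c.M c.k) U₀ →
          7 * (4 : ℕ) * (F.L : ℝ) ^ 2 * c.M * α₀ ≤ c₁ → GaugedBoundB8 F.L η U₀ c (7 * (4 : ℕ) * (F.L : ℝ) ^ 2 * B₁ * c.M * α₀))) := by
  letI : CStarAlgebra (MatA 2) := {}
  refine exists_congr fun ρ₀ => exists_congr fun B₁ => exists_congr fun c₁ => ?_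
  rw [prop6Printed_zdCubP_iff_minimal (𝔸 := MatA 2) ρ₀ B₁ c₁]

/-- **SANITY AT THE K0 LETTERS**: V18's stub-2 conjunct (all cubes, `zdCub`) is the `ρ₀ = 1` print-class sentence (`minimalP_one_iff_minimal`).
[cite: Balaban1985RegularSpaces, Prop. 6 p.99 (bookkeeping)] -/
theorem prop6MemberB8At_iff_minimalP_one (B₁ c₁ : ℝ) :
    (letI : CStarAlgebra (MatA N) := {};
      B8.Prop6Printed 4 (F.L : ℝ) B₁ c₁ (fun i : ZdIdx 4 F.L => zdCub (MatA N) F.L i)) ↔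
    (letI : CStarAlgebra (MatA N) := {};
      ∀ (η : ℝ), 0 < η → ∀ {K : ℕ} {Ω : ℕ → Set (Site 4)} (c : CubeB8 4 F.L K Ω), c.IsPrint 1 → ∀ (α₀ : ℝ), 0 < α₀ →
        ∀ (U₀ : Site 4 → Fin 4 → (MatA N)ˣ), (∀ x κ, U₀ x κ ∈ unitaryUnits (MatA N)) →
        (∀ j, j < c.k → CondAt F.L η α₀ j (tcube F.L c.a c.M c.ρ c.k) U₀) → CondAt F.L η α₀ c.k (box F.L c.a c.M c.k) U₀ →
        7 * (4 : ℕ) * (F.L : ℝ) ^ 2 * c.M * α₀ ≤ c₁ → GaugedBoundB8 F.L η U₀ c (7 * (4 : ℕ) * (F.L : ℝ) ^ 2 * B₁ * c.M * α₀)) := by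
  letI : CStarAlgebra (MatA N) := {}
  exact (minimalP_one_iff_minimal (𝔸 := MatA N) B₁ c₁).symm

/-- **WLOG `F.L ∣ ρ₀` IN V19's STUB-2′ BODY** (the side conditions `0 ≤ B₁ ∧ 0 < c₁` do not read `ρ₀`): a witness at `ρ₀` is a witness at `ρ₀·L` — so the body is
equivalent to its restriction to big blocks that are multiples of `L` (the shape dag-n07-e's bare-block tokens `…_of_one_le` produce, block `ρ₀·F.L`).
[cite: Balaban1985RegularSpaces, Prop. 6 p.99, p.98 (bookkeeping)] -/
theorem prop6MemberB8AtPBody_iff_dvd_L :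
    (∃ ρ₀ : ℕ, ∃ B₁ c₁ : ℝ, 1 ≤ ρ₀ ∧ 0 ≤ B₁ ∧ 0 < c₁ ∧
      (letI : CStarAlgebra (MatA 2) := {};
        B8.Prop6Printed 4 (F.L : ℝ) B₁ c₁ (fun i : ZdIdx 4 F.L => zdCubP (MatA 2) F.L ρ₀ i))) ↔
    (∃ ρ₀ : ℕ, ∃ B₁ c₁ : ℝ, 1 ≤ ρ₀ ∧ F.L ∣ ρ₀ ∧ 0 ≤ B₁ ∧ 0 < c₁ ∧
      (letI : CStarAlgebra (MatA 2) := {};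
        B8.Prop6Printed 4 (F.L : ℝ) B₁ c₁ (fun i : ZdIdx 4 F.L => zdCubP (MatA 2) F.L ρ₀ i))) := by
  letI : CStarAlgebra (MatA 2) := {}
  have hL : 1 ≤ F.L := by obtain ⟨⟨r, hr⟩, h1⟩ := F.hL; omega
  exact exists_prop6Printed_zdCubP_iff_dvd (𝔸 := MatA 2) hL

end K0Letters

end Summit.QuantumFields.YangMills.Theorems.K0Stub2PrimeDatumForm

end
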